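import Literature.MathematicalPhysics.QuantumLattice.KohnLuttinger
import Mathlib.MeasureTheory.Integral.Prod
import Mathlib.MeasureTheory.Measure.Haar.InnerProductSpace
import Mathlib.Analysis.SpecialFunctions.Trigonometric.Complex
import HarnessLib

/-!
# Measurability of the Lindhard function and of the Kohn–Luttinger kernel

Topic `Literature/MathematicalPhysics/QuantumLattice`; basic API for `KohnLuttinger.lean` that every
quantitative statement about `pairingForm` / `channelInf` needs and that the definitions file leaves
implicit: for a measurable (e.g. continuous) dispersion `ε`,

* `measurable_lindhardIntegrand_uncurry` — the zero-temperature Lindhard integrand is jointly Borel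
  measurable in `(q, p)`;
* `measurable_kohnLuttingerKernel_uncurry` — `(k, k') ↦ Γ(k, k') = U + U² χ(k + k')` is jointly
  measurable (`q ↦ χ(q)` is a parametric Bochner integral of a jointly measurable integrand, Fubini
  measurability), `measurable_kohnLuttingerKernel_right/left` — and separately measurable;
* `volume_levelSet_squareDispersion` — every level set `{ε = μ}` of `ε = squareDispersion 1 0` is
  Lebesgue-null in momentum space (each slice `k₀ = const` is countable), via the volume-preserving
  `measurePreserving_momentum_prod : Momentum → ℝ × ℝ`;
* `isBounded_brillouinZone`, `volume_brillouinZone_lt_top`.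

(`Measurable (squareDispersion t t')`, `MeasurableSet brillouinZone`, `Measurable (fermiOccupation ε μ)`
and `Measurable (lindhardFunction ε μ)` are already in the tree, in
`Summits/HubbardSuperconductivity/…/Theorems/WeakCouplingBCSWcbcsKohnLuttingerB1gReduction.lean`;
they are not restated here.)

Everything is proved; no definitions. [folklore]
-/

noncomputable section

open MeasureTheory Set Real
open scoped ENNReal

namespace Literature.MathematicalPhysics.QuantumLattice

variable {ε : Momentum → ℝ}

/-- **The Lindhard integrand is jointly measurable** in `(q, p)` (the Fermi occupation
`𝟙[ε p < μ]` is measurable for measurable `ε`; cf. the same statement proved inside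
`Summits/…/WeakCouplingBCSWcbcsKohnLuttingerB1gReduction.lean`, which a Literature file cannot
import). [folklore] -/
theorem measurable_lindhardIntegrand_uncurry (hε : Measurable ε) (μ : ℝ) :
    Measurable fun x : Momentum × Momentum => lindhardIntegrand ε μ x.1 x.2 := by
  have hocc : Measurable (fermiOccupation ε μ) := by
    unfold fermiOccupation
    exact Measurable.ite (measurableSet_lt hε measurable_const) measurable_const measurable_const
  have hA : Measurable fun x : Momentum × Momentum => fermiOccupation ε μ x.2 := hocc.comp measurable_snd
  have hB : Measurable fun x : Momentum × Momentum => fermiOccupation ε μ (x.2 + x.1) :=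
    hocc.comp (measurable_snd.add measurable_fst)
  have hD : Measurable fun x : Momentum × Momentum => ε (x.2 + x.1) - ε x.2 :=
    (hε.comp (measurable_snd.add measurable_fst)).sub (hε.comp measurable_snd)
  unfold lindhardIntegrand
  exact Measurable.ite (measurableSet_eq_fun hA hB) measurable_const ((hA.sub hB).div hD)

/-- The Lindhard integrand at fixed `q` is measurable in `p`. [folklore] -/
theorem measurable_lindhardIntegrand (hε : Measurable ε) (μ : ℝ) (q : Momentum) :
    Measurable (lindhardIntegrand ε μ q) := by
  have h := (measurable_lindhardIntegrand_uncurry hε μ).comp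
    ((measurable_const (a := q)).prodMk measurable_id)
  exact h

/-- **The Kohn–Luttinger kernel is jointly measurable** in `(k, k')` (the Lindhard function is
measurable: Fubini measurability of a parametric Bochner integral). [folklore] -/
theorem measurable_kohnLuttingerKernel_uncurry (hε : Measurable ε) (μ U : ℝ) :
    Measurable fun x : Momentum × Momentum => kohnLuttingerKernel ε μ U x.1 x.2 := by
  have hχ : Measurable (lindhardFunction ε μ) := by
    have hsm : StronglyMeasurable (Function.uncurry fun (q p : Momentum) => lindhardIntegrand ε μ q p) :=
      (measurable_lindhardIntegrand_uncurry hε μ).stronglyMeasurable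
    have h : StronglyMeasurable fun q : Momentum => ∫ p in brillouinZone, lindhardIntegrand ε μ q p :=
      StronglyMeasurable.integral_prod_right (ν := volume.restrict brillouinZone) hsm
    unfold lindhardFunction
    exact h.measurable.div_const _
  have h1 : Measurable fun x : Momentum × Momentum => lindhardFunction ε μ (x.1 + x.2) :=
    hχ.comp (measurable_fst.add measurable_snd)
  have h2 : Measurable fun x : Momentum × Momentum => U + U ^ 2 * lindhardFunction ε μ (x.1 + x.2) :=
    (h1.const_mul (U ^ 2)).const_add U
  unfold kohnLuttingerKernel
  exact h2

/-- The kernel at fixed `k` is measurable in `k'`. [folklore] -/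
theorem measurable_kohnLuttingerKernel_right (hε : Measurable ε) (μ U : ℝ) (k : Momentum) :
    Measurable (kohnLuttingerKernel ε μ U k) := by
  have h := (measurable_kohnLuttingerKernel_uncurry hε μ U).comp
    ((measurable_const (a := k)).prodMk measurable_id)
  exact h

/-- The kernel at fixed `k'` is measurable in `k`. [folklore] -/
theorem measurable_kohnLuttingerKernel_left (hε : Measurable ε) (μ U : ℝ) (k' : Momentum) :
    Measurable fun k => kohnLuttingerKernel ε μ U k k' := by
  have h := (measurable_kohnLuttingerKernel_uncurry hε μ U).comp
    (measurable_id.prodMk (measurable_const (a := k')))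
  exact h

/-! ### The Brillouin zone -/

/-- The Brillouin zone is bounded. [folklore] -/
theorem isBounded_brillouinZone : Bornology.IsBounded brillouinZone := by
  rw [Metric.isBounded_iff_subset_closedBall (0 : Momentum)]
  refine ⟨2 * π, fun k hk => ?_⟩
  rw [Metric.mem_closedBall, dist_zero_right, EuclideanSpace.norm_eq]
  have hk' : ∀ i, |k i| ≤ π := fun i => by
    have := hk i
    rw [abs_le]; exact ⟨this.1, this.2.le⟩
  have hsum : ∑ i : Fin 2, ‖k i‖ ^ 2 ≤ 2 * π ^ 2 := by
    rw [Fin.sum_univ_two]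
    have h0 := hk' 0; have h1 := hk' 1
    simp only [Real.norm_eq_abs]
    nlinarith [abs_nonneg (k 0), abs_nonneg (k 1), Real.pi_pos]
  calc Real.sqrt (∑ i : Fin 2, ‖k i‖ ^ 2) ≤ Real.sqrt (2 * π ^ 2) := Real.sqrt_le_sqrt hsum
    _ ≤ 2 * π := by
        rw [Real.sqrt_le_left (by positivity)]
        nlinarith [Real.pi_pos]

/-- The Brillouin zone has finite volume. [folklore] -/
theorem volume_brillouinZone_lt_top : volume brillouinZone < ⊤ :=
  isBounded_brillouinZone.measure_lt_top

/-! ### Level sets of the square-lattice dispersion are Lebesgue-null -/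

/-- A level set `{y | cos y = a}` of the cosine is countable. [folklore] -/
theorem countable_setOf_cos_eq (a : ℝ) : Set.Countable {y : ℝ | cos y = a} := by
  by_cases h : ∃ y₀, cos y₀ = a
  · obtain ⟨y₀, hy₀⟩ := h
    have hsub : {y : ℝ | cos y = a} ⊆
        range (fun k : ℤ => 2 * (k : ℝ) * π + y₀) ∪ range (fun k : ℤ => 2 * (k : ℝ) * π - y₀) := by
      intro y hy
      have hc : cos y₀ = cos y := by rw [hy₀]; exact hy.symm
      obtain ⟨k, hk | hk⟩ := Real.cos_eq_cos_iff.1 hc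
      · exact Or.inl ⟨k, hk.symm⟩
      · exact Or.inr ⟨k, hk.symm⟩
    exact ((countable_range _).union (countable_range _)).mono hsub
  · have : {y : ℝ | cos y = a} = ∅ := by
      ext y
      simp only [mem_setOf_eq, mem_empty_iff_false, iff_false]
      exact fun hy => h ⟨y, hy⟩
    rw [this]; exact countable_empty

/-- The measurable equivalence `Momentum ≃ᵐ ℝ × ℝ`, `k ↦ (k₀, k₁)`, is volume preserving.
[folklore] -/
theorem measurePreserving_momentum_prod :
    MeasurePreserving (fun k : Momentum => ((k 0, k 1) : ℝ × ℝ)) volume volume := by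
  have h1 := PiLp.volume_preserving_ofLp (Fin 2)
  have h2 := MeasureTheory.volume_preserving_finTwoArrow ℝ
  exact h2.comp h1

/-- **Level sets of the square-lattice dispersion are Lebesgue-null**: for every `μ`,
`vol {k | -2(cos k₀ + cos k₁) = μ} = 0` (every slice `k₀ = const` is a countable set).
[folklore] -/
theorem volume_levelSet_squareDispersion (μ : ℝ) :
    volume {p : Momentum | squareDispersion 1 0 p = μ} = 0 := by
  set T : Set (ℝ × ℝ) := {x | -2 * (cos x.1 + cos x.2) = μ} with hT
  have hTmeas : MeasurableSet T := by
    refine (isClosed_eq ?_ continuous_const).measurableSet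
    fun_prop
  have hpre : {p : Momentum | squareDispersion 1 0 p = μ} =
      (fun k : Momentum => ((k 0, k 1) : ℝ × ℝ)) ⁻¹' T := by
    ext p; simp [hT, squareDispersion]
  rw [hpre, measurePreserving_momentum_prod.measure_preimage hTmeas.nullMeasurableSet]
  rw [show (volume : Measure (ℝ × ℝ)) = (volume : Measure ℝ).prod volume from rfl,
    Measure.measure_prod_null hTmeas]
  refine Filter.Eventually.of_forall fun x => ?_
  have hslice : Prod.mk x ⁻¹' T = {y : ℝ | cos y = -μ / 2 - cos x} := by
    ext y
    simp only [hT, mem_preimage, mem_setOf_eq]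
    constructor <;> intro h <;> linarith
  simp only [Pi.zero_apply, hslice]
  exact (countable_setOf_cos_eq _).measure_zero volume


/-! ### The exact form of the Lindhard integrand -/

/-- **Exact form of the zero-temperature Lindhard integrand.** Where the two occupations differ, one of
`ε p`, `ε (p + q)` lies strictly below `μ` and the other at or above it, so the energy denominator is
the SUM of the two distances to the Fermi level:
`(f(ε p) - f(ε (p+q))) / (ε (p+q) - ε p) = 1 / (|ε p - μ| + |ε (p+q) - μ|)`; where they agree the
integrand is `0` by definition.  (This identity is what makes `χ(q)` a two-shell overlap integral.)
[cite: RaghuKivelsonScalapino2010, §II (5)] -/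
theorem lindhardIntegrand_eq_ite_inv (ε : Momentum → ℝ) (μ : ℝ) (q p : Momentum) :
    lindhardIntegrand ε μ q p =
      if fermiOccupation ε μ p = fermiOccupation ε μ (p + q) then 0
      else 1 / (|ε p - μ| + |ε (p + q) - μ|) := by
  unfold lindhardIntegrand
  split_ifs with h
  · rfl
  · unfold fermiOccupation at h ⊢
    by_cases h1 : ε p < μ <;> by_cases h2 : ε (p + q) < μ
    · exact absurd (by rw [if_pos h1, if_pos h2]) h
    · rw [if_pos h1, if_neg h2, abs_of_neg (sub_neg.2 h1), abs_of_nonneg (sub_nonneg.2 (le_of_not_gt h2))]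
      have hne : ε (p + q) - ε p ≠ 0 := by linarith [le_of_not_gt h2]
      have hne' : -(ε p - μ) + (ε (p + q) - μ) ≠ 0 := by linarith [le_of_not_gt h2]
      field_simp
      ring
    · rw [if_neg h1, if_pos h2, abs_of_nonneg (sub_nonneg.2 (le_of_not_gt h1)), abs_of_neg (sub_neg.2 h2)]
      have hne : ε (p + q) - ε p ≠ 0 := by linarith [le_of_not_gt h1]
      have hne' : (ε p - μ) + -(ε (p + q) - μ) ≠ 0 := by linarith [le_of_not_gt h1]
      field_simp
      ring
    · exact absurd (by rw [if_neg h1, if_neg h2]) h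

/-- The Lindhard integrand is dominated by the inverse of the summed distances to the Fermi level:
`0 ≤ lindhardIntegrand ε μ q p ≤ 1 / (|ε p - μ| + |ε (p+q) - μ|)` (with Lean's `1 / 0 = 0` the bound
also holds, trivially, where both points lie on the Fermi curve). [cite: RaghuKivelsonScalapino2010, §II (5)] -/
theorem lindhardIntegrand_le_inv (ε : Momentum → ℝ) (μ : ℝ) (q p : Momentum) :
    lindhardIntegrand ε μ q p ≤ 1 / (|ε p - μ| + |ε (p + q) - μ|) := by
  rw [lindhardIntegrand_eq_ite_inv]
  split_ifs
  · exact div_nonneg zero_le_one (add_nonneg (abs_nonneg _) (abs_nonneg _))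
  · exact le_rfl

end Literature.MathematicalPhysics.QuantumLattice

end
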